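import Literature.RingTheory.FormalGroups.FormalOModuleLaw
import Literature.NumberTheory.GaloisRepresentations.LubinTate
import Literature.NumberTheory.GaloisRepresentations.LubinTatePoints
import Mathlib.RingTheory.Ideal.Quotient.Operations
import HarnessLib

/-!
# The Lubin–Tate formal group `F_f` IS a formal `A`-module law, of height one modulo `π`
# (Lubin–Tate 1965, Thm. 1; Harris–Taylor II.1 `Σ_{K,1}`) — a bridge file

Topic `Literature/RingTheory/FormalGroups`; namespace `Literature.RingTheory.FormalGroups`. DEFINITIONS (two packagings)
+ fully proved theorems; no named fact, no instance, no notation, no `sorry`. Cell `hodgecm-mathlib`, P6 «MOD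
programme» Row 4B (sub-desk P6d «Lubin–Tate formal moduli»): the organ «`Σ_{K,1}` = the Lubin–Tate formal `𝒪_K`-module
of height 1» stated ON the desk's interface `FormalOModuleLaw` (`FormalOModuleLaw.lean`, F0P3b-p01) and PROVED FROM the
tree's Lubin–Tate theory `Literature/NumberTheory/GaloisRepresentations/LubinTate.lean` (Lubin–Tate's Lemma 1
`LubinTate.exists_unique`, the law `LubinTate.formalGroup hA hf = F_f`, the series `LubinTate.hom hA hf hg a = [a]_{f,g}`
with `hom_add`, `hom_comp_hom`, `hom_one`, `hom_self_eq`, `ltF_subst_homX`, and `hom_zero'` of `LubinTatePoints.lean`).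
Nothing is re-proved here: every field below is one of those ★ theorems BY NAME.

* `lubinTateHom hA hf hg a : FormalGroupHom F_g F_f` — Lubin–Tate's `[a]_{f,g}` as a homomorphism of Mathlib formal
  group laws (Lubin–Tate 1965, Thm. 1 (8)); `lubinTateHom_comp` (`[a]_{f,g} ∘ [b]_{g,h} = [ab]_{f,h}`, (9)).
* `lubinTateModuleLaw hA hf : FormalOModuleLaw A A` — **`F_f` with `a ↦ [a]_f` is a formal `A`-module law over `A`**
  (Lubin–Tate 1965, Thm. 1: "`F_f` admits `A` as a ring of endomorphisms via `a ↦ [a]_f`"; Hazewinkel 1978 §21.1;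
  Harris–Taylor II.1); `lubinTateModuleLaw_act_self` (`[π]_f = f`, (11)).
* `isOfHeight_one_lubinTateModuleLaw_map` — **reduced modulo `π`, `F_f` has `𝒪`-height `1`** (`[π]_f ≡ f ≡ X^q (mod π)`):
  the formal `A`-module `Σ_{K,1}` of Harris–Taylor II.1 (p. 59) in the case `h = 1`.
* `lubinTateHom_one_comp_one`, `act_comp_lubinTateHom_one` — `[1]_{f,g} : F_g → F_f` is an isomorphism of formal
  `A`-module laws with inverse `[1]_{g,f}` (Lubin–Tate 1965, Thm. 1 (9)–(11): `F_f` is independent of `f` up to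
  canonical isomorphism).

## References
* [LubinTate1965] J. Lubin, J. Tate, *Formal complex multiplication in local fields*, Ann. of Math. 81 (1965), §1 Thm. 1.
* [HarrisTaylorAMS2001] M. Harris, R. Taylor, *The geometry and cohomology of some simple Shimura varieties* (2001), §II.1.
* [Hazewinkel1978] M. Hazewinkel, *Formal Groups and Applications* (1978), §21.1 (formal `A`-modules), §8.1.
-/

noncomputable section

namespace Literature.RingTheory.FormalGroups

open Literature.NumberTheory.GaloisRepresentations

variable {A : Type*} [CommRing A] {π : A} {q : ℕ} (hA : LubinTate.IsLTRing π q)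
  {f g h : PowerSeries A} (hf : LubinTate.IsLTSeries π q f) (hg : LubinTate.IsLTSeries π q g)
  (hh : LubinTate.IsLTSeries π q h)

/-! ## §1 `[a]_{f,g}` as a homomorphism of Mathlib formal group laws -/

/-- Lubin–Tate's series `[a]_{f,g}` (tree `LubinTate.hom hA hf hg a`) as a homomorphism of formal group laws
`F_g → F_f`: `[a]_{f,g}(F_g(X, Y)) = F_f([a]_{f,g}(X), [a]_{f,g}(Y))` is the tree's `LubinTate.ltF_subst_homX`.
[cite: LubinTate1965, §1 Thm. 1 (8)] -/
def lubinTateHom (a : A) :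
    FormalGroupHom (LubinTate.formalGroup hA hg) (LubinTate.formalGroup hA hf) where
  toPowerSeries := LubinTate.hom hA hf hg a
  constantCoeff_eq_zero := LubinTate.constantCoeff_hom hA hf hg a
  map_add := (LubinTate.ltF_subst_homX hA hf hg a).symm

/-- The series of `lubinTateHom` is `[a]_{f,g}` (unfolding). [cite: LubinTate1965, §1 Thm. 1 (8)] -/
@[simp] theorem lubinTateHom_toPowerSeries (a : A) :
    (lubinTateHom hA hf hg a).toPowerSeries = LubinTate.hom hA hf hg a := rfl

/-- The linear term of `[a]_{f,g}` is `a`. [cite: LubinTate1965, §1 Thm. 1 (5)] -/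
theorem coeff_one_lubinTateHom (a : A) : PowerSeries.coeff 1 (lubinTateHom hA hf hg a).toPowerSeries = a :=
  LubinTate.coeff_one_hom hA hf hg a

/-- **`[a]_{f,g} ∘ [b]_{g,h} = [ab]_{f,h}`** as homomorphisms `F_h → F_f` (tree `LubinTate.hom_comp_hom`).
[cite: LubinTate1965, §1 Thm. 1 (9)] -/
theorem lubinTateHom_comp (a b : A) :
    (lubinTateHom hA hf hg a).comp (lubinTateHom hA hg hh b) = lubinTateHom hA hf hh (a * b) :=
  FormalGroupHom.ext (LubinTate.hom_comp_hom hA hf hg hh a b)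

/-- `[1]_{f,f} = id_{F_f}` (tree `LubinTate.hom_one`). [cite: LubinTate1965, §1 Thm. 1 (11)] -/
theorem lubinTateHom_one : lubinTateHom hA hf hf 1 = FormalGroupHom.id _ :=
  FormalGroupHom.ext (LubinTate.hom_one hA hf)

/-- `[0]_{f,g} = 0` (tree `LubinTate.hom_zero'`). [cite: LubinTate1965, §1 Lemma 1] -/
theorem lubinTateHom_zero : lubinTateHom hA hf hg 0 = FormalGroupHom.zero _ _ :=
  FormalGroupHom.ext (LubinTate.hom_zero' hA hf hg)

/-! ## §2 `F_f` is a formal `A`-module law -/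

/-- **The Lubin–Tate formal `A`-module law `(F_f, a ↦ [a]_f)`** over `A` itself: `F_f` is a commutative formal group law
(tree `LubinTate.formalGroup`, `formalGroup_isComm`), `[a]_f ∈ End(F_f)` with `[a]_f ≡ aX (mod deg 2)`
(`coeff_one_hom`), `[0]_f = 0` (`hom_zero'`), `[1]_f = X` (`hom_one`), `[a + b]_f = F_f([a]_f, [b]_f)` (`hom_add`),
`[ab]_f = [a]_f ∘ [b]_f` (`hom_comp_hom`) — Lubin–Tate 1965, Thm. 1: "`a ↦ [a]_f` is an injective ring homomorphism of
`A` into `End(F_f)`". [cite: LubinTate1965, §1 Thm. 1] -/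
def lubinTateModuleLaw : FormalOModuleLaw A A where
  toFormalGroup := LubinTate.formalGroup hA hf
  isComm := LubinTate.formalGroup_isComm hA hf
  act := lubinTateHom hA hf hf
  coeff_one_act a := by
    rw [Algebra.algebraMap_self_apply]
    exact LubinTate.coeff_one_hom hA hf hf a
  act_zero := LubinTate.hom_zero' hA hf hf
  act_one := LubinTate.hom_one hA hf
  act_add a b := LubinTate.hom_add hA hf hf a b
  act_mul a b := (LubinTate.hom_comp_hom hA hf hf hf a b).symm

/-- The underlying law of the Lubin–Tate module law is `F_f` (unfolding). [cite: LubinTate1965, §1 Thm. 1] -/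
@[simp] theorem lubinTateModuleLaw_toFormalGroup :
    (lubinTateModuleLaw hA hf).toFormalGroup = LubinTate.formalGroup hA hf := rfl

/-- The action of the Lubin–Tate module law is `a ↦ [a]_f` (unfolding). [cite: LubinTate1965, §1 Thm. 1] -/
@[simp] theorem lubinTateModuleLaw_act (a : A) :
    (lubinTateModuleLaw hA hf).act a = lubinTateHom hA hf hf a := rfl

/-- **`[π]_f = f`**: the uniformiser acts on `F_f` by the chosen Lubin–Tate series itself (tree
`LubinTate.hom_self_eq`). [cite: LubinTate1965, §1 Thm. 1 (11)] -/
theorem lubinTateModuleLaw_act_self : ((lubinTateModuleLaw hA hf).act π).toPowerSeries = f :=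
  LubinTate.hom_self_eq hA hf

/-- Reduction of `[π]_f` modulo `π` is `X ^ q` (tree `LubinTate.IsLTSeries.map_mk`). [cite: LubinTate1965, §1 Thm. 1 (11)] -/
theorem map_mk_lubinTateModuleLaw_act_self :
    PowerSeries.map (Ideal.Quotient.mk (Ideal.span {π})) ((lubinTateModuleLaw hA hf).act π).toPowerSeries =
      PowerSeries.X ^ q := by
  rw [lubinTateModuleLaw_act_self]
  exact hf.map_mk

/-- **`Σ_{K,1}`: reduced modulo `π`, the Lubin–Tate module law has `𝒪`-height one** — its base change along
`A → A ⧸ (π)` satisfies `[π] = u(X^{q^1})` with `u = X` (Harris–Taylor II.1: "up to isomorphism there is a unique formal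
`𝒪_K`-module `Σ_{K,h}` over `k^{ac}` of height `h`"; here the existence half for `h = 1`, over `A ⧸ (π)` itself).
[cite: HarrisTaylorAMS2001, §II.1 p. 59] -/
theorem isOfHeight_one_lubinTateModuleLaw_map :
    ((lubinTateModuleLaw hA hf).map (Ideal.Quotient.mkₐ A (Ideal.span {π}))).IsOfHeight π q 1 := by
  obtain ⟨p, r, hp, hq, -⟩ := hA.exists_prime
  have hq0 : q ^ 1 ≠ 0 := by rw [pow_one, hq]; exact pow_ne_zero r hp.ne_zero
  refine ⟨PowerSeries.X, PowerSeries.constantCoeff_X, by rw [PowerSeries.coeff_one_X]; exact isUnit_one, ?_⟩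
  rw [FormalOModuleLaw.map_act, FormalGroupHom.map_toPowerSeries, PowerSeries.subst_X (PowerSeries.HasSubst.X_pow hq0),
    pow_one]
  exact map_mk_lubinTateModuleLaw_act_self hA hf

/-! ## §3 `F_f` does not depend on `f`: the canonical isomorphisms `[1]_{f,g}` -/

/-- **`[1]_{f,g} ∘ [1]_{g,f} = id_{F_f}`**: the canonical homomorphism `[1]_{f,g} : F_g → F_f` is an isomorphism of
formal group laws with inverse `[1]_{g,f}` (Lubin–Tate 1965, Thm. 1 (9), (11)). [cite: LubinTate1965, §1 Thm. 1 (9)] -/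
theorem lubinTateHom_one_comp_one :
    (lubinTateHom hA hf hg 1).comp (lubinTateHom hA hg hf 1) = FormalGroupHom.id _ := by
  rw [lubinTateHom_comp, mul_one, lubinTateHom_one]

/-- **`[a]_f ∘ [1]_{f,g} = [1]_{f,g} ∘ [a]_g`** (both are `[a]_{f,g}`): the canonical isomorphism `F_g ≅ F_f` is
`A`-LINEAR, i.e. an isomorphism of the formal `A`-module laws `lubinTateModuleLaw hA hg ≅ lubinTateModuleLaw hA hf`
(Lubin–Tate 1965, Thm. 1 (9)). [cite: LubinTate1965, §1 Thm. 1 (9)] -/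
theorem act_comp_lubinTateHom_one (a : A) :
    ((lubinTateModuleLaw hA hf).act a).comp (lubinTateHom hA hf hg 1) =
      (lubinTateHom hA hf hg 1).comp ((lubinTateModuleLaw hA hg).act a) := by
  apply FormalGroupHom.ext
  change PowerSeries.subst (LubinTate.hom hA hf hg 1) (LubinTate.hom hA hf hf a) =
    PowerSeries.subst (LubinTate.hom hA hg hg a) (LubinTate.hom hA hf hg 1)
  rw [LubinTate.hom_comp_hom, LubinTate.hom_comp_hom, mul_one, one_mul]

/-- `[a]_{f,g} = [a]_f ∘ [1]_{f,g}`: every Lubin–Tate homomorphism factors through the canonical isomorphism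
(Lubin–Tate 1965, Thm. 1 (9)). [cite: LubinTate1965, §1 Thm. 1 (9)] -/
theorem lubinTateHom_eq_act_comp_one (a : A) :
    lubinTateHom hA hf hg a = ((lubinTateModuleLaw hA hf).act a).comp (lubinTateHom hA hf hg 1) := by
  apply FormalGroupHom.ext
  change LubinTate.hom hA hf hg a = PowerSeries.subst (LubinTate.hom hA hf hg 1) (LubinTate.hom hA hf hf a)
  rw [LubinTate.hom_comp_hom, mul_one]

end Literature.RingTheory.FormalGroups
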